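import Summits.QuantumFields.BalabanUV.Beta.CombHId2W2Sym
import Summits.QuantumFields.BalabanUV.Beta.CombHId2Record

/-!
# `BalabanUV.Beta.CombHId2W2SymSwap` — binder row D1 (OWNER an2), (J-a) dictionary, (C2) at ORDER 2, part TWO-c (assembly, end): **THE SWAPPED ORIENTATION
# `W2OfK (b′+M′∘n) b` BY THE TABLE's JOINT BLOCK COVARIANCE, AND `W2SymOfK` COPY-SUMMED AND PERIODISED** —
# `dper M (x z ↦ Σ'_n W2SymOfK K N S Mt S₂ M₂ b (b′+M′∘n) x z) = W2SymOfK K N S^per Mt^per S₂^{per,csf} M₂^{per,cs} b b′`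

WHY.  `W2SymOfK b b′ = ½(W2OfK b b′ + W2OfK b′ b)` (`SecondOrderResponse` :966).  `CombHId2W2Sym` periodised the first summand under the copy sum in `b′`; in the second
the moving bond is the FIRST argument.  No new word is needed: by the joint block covariance `W2OfK μ (y+t) ν (y′+t) = shiftK (−N•t) (W2OfK μ y ν y′)`
(`SecondOrderResponse.W2OfK_translate`) the copy `W2OfK (b′+M′∘n) b` is the fine-period SHIFT of `W2OfK b′ (b − M′∘n)`; `dper` passes the copy sum
(`CombHId2W2Slot.dper_tsum_family'`, moving centres), forgets the shift (C3c `dper_shiftK_per`), and the re-indexed sum is the unswapped statement with the bonds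
exchanged.  The full block covariances `hKs hSs hMs hS₂s hM₂s` are the record's `(TG)(St)(TM)(TB)(Tmix)` letters; the period forms follow by the bridges of §10.
WHAT ([folklore]; 0 `def`, 0 cited fact, 0 `def … : Prop`, 0 sorry): §10 bridges `shiftK_pos_of_neg`, `fmperiodCov_of_shiftK_cov`, `cperiodCov_of_shiftK_cov'`;
`exists_farSmall_W2OfK`; `W2OfK_copy_eq_shiftK`; **`dper_tsum_W2OfK_translate_swap`**; `exp_thirds_far`, `biLoc_tsum_swap` (the swapped copy sum is
bi-localised at the FIXED bond, rate `δw∕3`); **`dper_tsum_W2SymOfK_translate`**.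
NOT HERE: the record instance (`WcombOf j`), PART THREE; nothing of Bałaban's asserted; NOT D1, NEVER «G-an2-4 closed», NOT BetaPertH, NOT continuum, NOT Clay.

HONEST DEPENDENCY (page 1, mandatory): continuum YM on T⁴ ⇐ BetaPertH ∧ nine spine estimates (0/9 proved); BetaPertH ⇐ (D1) ∧ (D4) ∧ CAP+tail;
G-an2-4 gates asym, D1 and NE2/3/4.  HONEST FRAMING (cell contract, verbatim): «discharging `BetaPertH` makes Bałaban's UV stability UNCONDITIONAL —
a real constructive-QFT result; it is NOT the continuum limit and NOT the Clay problem.»  ABSOLUTE RULE (cell charter, verbatim): «No internally-minted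
statement may enter as a cited fact. Every hypothesis is either kernel-proved in this package or a verbatim quotation of a PUBLISHED theorem with page
reference. The manuscript(s) under audit are NOT citable for their own disputed steps — they are the thing under adjudication; programme-internal
(2001/route/tribunal) claims are never citable.»  Row D1 OWNER an2 (b2b-balaban-beta-an2) gen 44, 2026-08-23; over `CombHId2W2Sym` and `SecondOrderResponse` BY NAME.
-/

noncomputable section

open scoped BigOperators

namespace Summit.QuantumFields.BalabanUV.Beta.CombHId2W2SymSwap

open Literature.MathematicalPhysics.QuantumFieldTheory.Balaban1983to89
open Literature.MathematicalPhysics.QuantumFieldTheory.Balaban1983to89.Beta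
open B12Sec2to5 (l1 l1_nonneg)
open B4TorusKernel.MultiPeriod (translate translate_apply)
open B4Reflection242 (translate_translate)
open B4Sect5Proof (latticeConst latticeConst_nonneg)
open ExpKernelCalculus (MKer Decays BiLoc VertexFamily VertexFamily₂ comp shiftK l1_sub_symm)
open AffineAveraging (Site)
open OneStepResolventKernel (Fib LocStencil biLoc_mono decays_mono)
open BalabanCompositeJets (LocStencil₂)
open BalabanStepJets (locStencil_mono)
open BalabanStepW2 (biLoc_le_mono biLoc_far_of_pair)
open SecondOrderResponse (W2OfK W2SymOfK LocStencilFM W2OfK_translate)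
open Summit.QuantumFields.BalabanUV.Beta.FP.KernelPeriodisationFib (translate_eq_add translate_invariant_of_shiftK)
open Summit.QuantumFields.BalabanUV.Beta.FP.KernelPeriodisationFibLoc (dper dper_apply summable_dper summable_exp_l1_translate shiftK_eq_translate)
open Summit.QuantumFields.BalabanUV.Beta.CombHId1Letters (periodCov_of_shiftK_cov nsmul_translate)
open Summit.QuantumFields.BalabanUV.Beta.CombHId2CopySum (biLoc_tsum_family nsmul_per neg_nsmul_per dper_shiftK_per)
open Summit.QuantumFields.BalabanUV.Beta.CombHId2W2Letters (exp_rate_mono exp_half_triangle)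
open Summit.QuantumFields.BalabanUV.Beta.CombHId2W2Slot (dper_tsum_family')
open Summit.QuantumFields.BalabanUV.Beta.CombHId2W2Sym (summable_of_vertexFamily₂ dper_tsum_W2OfK_translate)

variable {d : ℕ} (M : Fin (d + 1) → ℕ) [∀ μ, NeZero (M μ)] {N : ℕ} [NeZero N] {M' : Fin (d + 1) → ℕ} {K : MKer (d + 1) (Fib d)}
  {CK δK CS δS CM δM C₂ δ₂ Cm δm : ℝ} {S Mt : Fin (d + 1) → Site (d + 1) → MKer (d + 1) (Fib d)}
  {S₂ M₂ : Fin (d + 1) → Site (d + 1) → Fin (d + 1) → Site (d + 1) → MKer (d + 1) (Fib d)}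

/-! ## §10a Bridges from the record's block covariances to the period forms -/

section Bridges

omit [∀ μ, NeZero (M μ)] [NeZero N]

/-- [folklore] `shiftK (−N•t) K = K` for all `t` gives `shiftK (N•t) K = K` for all `t`. -/
theorem shiftK_pos_of_neg (hKs : ∀ t : Site (d + 1), shiftK (-((N : ℤ) • t)) K = K) (t : Site (d + 1)) : shiftK ((N : ℤ) • t) K = K := by
  have h := hKs (-t); rwa [smul_neg, neg_neg] at h

/-- [folklore] bridge for COARSE-bond families: the record's `(TM)` shape gives `M′`-period covariance on the fine box `M = N·M′`. -/
theorem cperiodCov_of_shiftK_cov' (hM : ∀ i, M i = N * M' i)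
    (hMs : ∀ (ρ : Fin (d + 1)) (w t : Site (d + 1)), Mt ρ (w + t) = shiftK (-((N : ℤ) • t)) (Mt ρ w))
    (ρ : Fin (d + 1)) (w m x z : Site (d + 1)) (a b : Fib d) :
    Mt ρ (translate M' w m) (translate M x m) (translate M z m) a b = Mt ρ w x z a b := by
  rw [translate_eq_add M' w m, hMs ρ w, translate_eq_add M x m, translate_eq_add M z m, ← nsmul_per M hM m]
  show Mt ρ w (x + (N : ℤ) • (fun i => (M' i : ℤ) * m i) + -((N : ℤ) • fun i => (M' i : ℤ) * m i))
    (z + (N : ℤ) • (fun i => (M' i : ℤ) * m i) + -((N : ℤ) • fun i => (M' i : ℤ) * m i)) a b = Mt ρ w x z a b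
  rw [add_neg_cancel_right, add_neg_cancel_right]

/-- [folklore] bridge for the MIXED table: the record's `(Tmix)` shape gives the joint period covariance on the fine box. -/
theorem fmperiodCov_of_shiftK_cov (hM : ∀ i, M i = N * M' i)
    (hM₂s : ∀ (κ : Fin (d + 1)) (u : Site (d + 1)) (ρ : Fin (d + 1)) (w t : Site (d + 1)),
      M₂ κ (u + (N : ℤ) • t) ρ (w + t) = shiftK (-((N : ℤ) • t)) (M₂ κ u ρ w))
    (κ : Fin (d + 1)) (u : Site (d + 1)) (ρ : Fin (d + 1)) (w m x z : Site (d + 1)) (a c : Fib d) :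
    M₂ κ (translate M u m) ρ (translate M' w m) (translate M x m) (translate M z m) a c = M₂ κ u ρ w x z a c := by
  rw [translate_eq_add M u m, translate_eq_add M' w m, translate_eq_add M x m, translate_eq_add M z m, ← nsmul_per M hM m, hM₂s κ u ρ w]
  show M₂ κ u ρ w (x + (N : ℤ) • (fun i => (M' i : ℤ) * m i) + -((N : ℤ) • fun i => (M' i : ℤ) * m i))
    (z + (N : ℤ) • (fun i => (M' i : ℤ) * m i) + -((N : ℤ) • fun i => (M' i : ℤ) * m i)) a c = M₂ κ u ρ w x z a c
  rw [add_neg_cancel_right, add_neg_cancel_right]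

end Bridges

/-! ## §10b The operator's second response table is far-small at its first bond -/

/-- [folklore] **`W2OfK` IS FAR-SMALL AT ITS FIRST BOND**: `∃ Cw δw > 0, ∀ b b′, BiLoc (W2OfK … b b′) (N•b.2) (N•b.2) (Cw·e^{−δw|N•b′.2 − N•b.2|₁}) δw`
(`vertexFamily₂_W2OfK` + `vertexFamily₂_W2OfK_swap` at the common rate, then `biLoc_far_of_pair`). -/
theorem exists_farSmall_W2OfK (hK : Decays K CK δK) (hCK : 0 ≤ CK) (hδK : 0 < δK) (hS : ∀ κ u, BiLoc (S κ u) u u CS δS) (hδS : 0 < δS)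
    (hMloc : VertexFamily Mt N CM δM) (hδM : 0 < δM) (hS₂ : LocStencil₂ S₂ C₂ δ₂) (hδ₂ : 0 < δ₂) (hM₂ : LocStencilFM N M₂ Cm δm) (hδm : 0 < δm) :
    ∃ Cw δw : ℝ, 0 < δw ∧ ∀ (μ : Fin (d + 1)) (y : Site (d + 1)) (ν : Fin (d + 1)) (y' : Site (d + 1)),
      BiLoc (W2OfK K N S Mt S₂ M₂ μ y ν y') ((N : ℤ) • y) ((N : ℤ) • y) (Cw * Real.exp (-δw * l1 ((N : ℤ) • y' - (N : ℤ) • y))) δw := by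
  have hCS : 0 ≤ CS := (hS 0 0).nonneg (Sum.inl 0)
  have hCMt : 0 ≤ CM := (hMloc 0 0).nonneg (Sum.inl 0)
  set m : ℝ := min (min (min (min δK δS) δM) δ₂) δm with hm_def
  have hm : 0 < m := lt_min (lt_min (lt_min (lt_min hδK hδS) hδM) hδ₂) hδm
  have hKm : Decays K CK m := decays_mono hK hCK le_rfl ((min_le_left _ _).trans ((min_le_left _ _).trans ((min_le_left _ _).trans (min_le_left _ _))))
  have hSm : LocStencil S CS m := fun κ u =>
    biLoc_mono (hS κ u) hCS ((min_le_left _ _).trans ((min_le_left _ _).trans ((min_le_left _ _).trans (min_le_right _ _))))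
  have hMm : VertexFamily Mt N CM m := BalabanStepW2.vertexFamily_mono' hMloc hCMt ((min_le_left _ _).trans ((min_le_left _ _).trans (min_le_right _ _)))
  have hS₂m : LocStencil₂ S₂ C₂ m := hS₂.mono ((min_le_left _ _).trans (min_le_right _ _))
  have hM₂m : LocStencilFM N M₂ Cm m := hM₂.mono (min_le_right _ _)
  have h1 := SecondOrderResponse.vertexFamily₂_W2OfK (N := N) hKm hCK hm hSm hMm hS₂m hM₂m
  have h2 := SecondOrderResponse.vertexFamily₂_W2OfK_swap (N := N) hKm hCK hm hSm hMm hS₂m hM₂m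
  have hCw : 0 ≤ SecondOrderResponse.CW2 d CK CS CM C₂ Cm m := (h1 0 0 0 0).nonneg (Sum.inl 0)
  refine ⟨SecondOrderResponse.CW2 d CK CS CM C₂ Cm m, m / 16 / 4, by positivity, fun μ y ν y' => ?_⟩
  have hp : BiLoc (W2OfK K N S Mt S₂ M₂ μ y ν y') ((N : ℤ) • y) ((N : ℤ) • y') _ (m / 16) := h1 μ y ν y'
  have hq : BiLoc (W2OfK K N S Mt S₂ M₂ μ y ν y') ((N : ℤ) • y') ((N : ℤ) • y) _ (m / 16) := h2 ν y' μ y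
  refine biLoc_le_mono (biLoc_far_of_pair hp hq (by positivity)) (by positivity) ?_ le_rfl
  exact mul_le_mul_of_nonneg_left (Real.exp_le_exp.2 (by nlinarith [l1_nonneg ((N : ℤ) • y' - (N : ℤ) • y)])) hCw

/-! ## §10c The swapped orientation -/

omit [∀ μ, NeZero (M μ)] in
/-- [folklore] **THE COPY `W2OfK (b′+M′∘n) b` IS THE FINE-PERIOD SHIFT OF `W2OfK b′ (b − M′∘n)`** (`SecondOrderResponse.W2OfK_translate` at `t := M′∘n`). -/
theorem W2OfK_copy_eq_shiftK (hM : ∀ i, M i = N * M' i) (hKs : ∀ t : Site (d + 1), shiftK (-((N : ℤ) • t)) K = K)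
    (hSs : ∀ (κ : Fin (d + 1)) (u t : Site (d + 1)), S κ (u + (N : ℤ) • t) = shiftK (-((N : ℤ) • t)) (S κ u))
    (hMs : ∀ (ρ : Fin (d + 1)) (w t : Site (d + 1)), Mt ρ (w + t) = shiftK (-((N : ℤ) • t)) (Mt ρ w))
    (hS₂s : ∀ (κ : Fin (d + 1)) (u : Site (d + 1)) (κ' : Fin (d + 1)) (u' t : Site (d + 1)),
      S₂ κ (u + (N : ℤ) • t) κ' (u' + (N : ℤ) • t) = shiftK (-((N : ℤ) • t)) (S₂ κ u κ' u'))
    (hM₂s : ∀ (κ : Fin (d + 1)) (u : Site (d + 1)) (ρ : Fin (d + 1)) (w t : Site (d + 1)),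
      M₂ κ (u + (N : ℤ) • t) ρ (w + t) = shiftK (-((N : ℤ) • t)) (M₂ κ u ρ w))
    (ν : Fin (d + 1)) (y' : Site (d + 1)) (μ : Fin (d + 1)) (y n : Site (d + 1)) :
    W2OfK K N S Mt S₂ M₂ ν (translate M' y' n) μ y = shiftK (fun i => (M i : ℤ) * (-n) i) (W2OfK K N S Mt S₂ M₂ ν y' μ (translate M' y (-n))) := by
  have hy : y = translate M' y (-n) + (fun i => (M' i : ℤ) * n i) := by
    rw [← translate_eq_add, translate_translate, neg_add_cancel, CombHId2Product.translate_zero_right]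
  rw [translate_eq_add M' y' n, ← neg_nsmul_per M hM n]
  conv_lhs => rw [hy]
  exact W2OfK_translate hKs hSs hMs hS₂s hM₂s ν y' μ (translate M' y (-n)) _

/-- [folklore] **THE SWAPPED ORIENTATION, PERIODISED**: under the full block covariances,
`dper M (x z ↦ Σ'_n W2OfK K N S Mt S₂ M₂ (b′+M′∘n) b x z) = W2OfK K N S^per Mt^per S₂^{per,csf} M₂^{per,cs} b′ b`. -/
theorem dper_tsum_W2OfK_translate_swap (hM : ∀ i, M i = N * M' i) (hKs : ∀ t : Site (d + 1), shiftK (-((N : ℤ) • t)) K = K)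
    (hK : Decays K CK δK) (hCK : 0 ≤ CK) (hδK : 0 < δK)
    (hSs : ∀ (κ : Fin (d + 1)) (u t : Site (d + 1)), S κ (u + (N : ℤ) • t) = shiftK (-((N : ℤ) • t)) (S κ u))
    (hS : ∀ κ u, BiLoc (S κ u) u u CS δS) (hδS : 0 < δS)
    (hMs : ∀ (ρ : Fin (d + 1)) (w t : Site (d + 1)), Mt ρ (w + t) = shiftK (-((N : ℤ) • t)) (Mt ρ w))
    (hMloc : VertexFamily Mt N CM δM) (hδM : 0 < δM)
    (hS₂s : ∀ (κ : Fin (d + 1)) (u : Site (d + 1)) (κ' : Fin (d + 1)) (u' t : Site (d + 1)),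
      S₂ κ (u + (N : ℤ) • t) κ' (u' + (N : ℤ) • t) = shiftK (-((N : ℤ) • t)) (S₂ κ u κ' u'))
    (hS₂ : LocStencil₂ S₂ C₂ δ₂) (hδ₂ : 0 < δ₂)
    (hM₂s : ∀ (κ : Fin (d + 1)) (u : Site (d + 1)) (ρ : Fin (d + 1)) (w t : Site (d + 1)),
      M₂ κ (u + (N : ℤ) • t) ρ (w + t) = shiftK (-((N : ℤ) • t)) (M₂ κ u ρ w))
    (hM₂ : LocStencilFM N M₂ Cm δm) (hδm : 0 < δm) (ν : Fin (d + 1)) (y' : Site (d + 1)) (μ : Fin (d + 1)) (y : Site (d + 1)) :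
    dper M (fun x z a c => ∑' n : Site (d + 1), W2OfK K N S Mt S₂ M₂ ν (translate M' y' n) μ y x z a c)
      = W2OfK K N (fun κ u => dper M (S κ u)) (fun ρ w => dper M (Mt ρ w))
          (fun κ u κ' u' => dper M (fun x z a c => ∑' n : Site (d + 1), S₂ κ u κ' (translate M u' n) x z a c))
          (fun κ u ρ w => dper M (fun x z a c => ∑' n : Site (d + 1), M₂ κ u ρ (translate M' w n) x z a c)) ν y' μ y := by
  have hLM : ∀ i, N ∣ M i := fun i => ⟨M' i, hM i⟩
  have hKinv : ∀ (m x z : Site (d + 1)) (a b : Fib d), K (translate M x m) (translate M z m) a b = K x z a b :=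
    translate_invariant_of_shiftK M (shiftK_pos_of_neg hKs) hLM
  have hSt := periodCov_of_shiftK_cov M hSs hLM
  have hMt := cperiodCov_of_shiftK_cov' M hM hMs
  have hM₂t := fmperiodCov_of_shiftK_cov M hM hM₂s
  obtain ⟨Cw, δw, hδw, hW⟩ := exists_farSmall_W2OfK (N := N) hK hCK hδK hS hδS hMloc hδM hS₂ hδ₂ hM₂ hδm
  have hCw : 0 ≤ Cw := by
    have h := (hW 0 0 0 0).nonneg (Sum.inl 0)
    rwa [sub_self, show l1 (0 : Site (d + 1)) = 0 by simp [l1], mul_zero, Real.exp_zero, mul_one] at h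
  funext x z a c
  -- (a) every copy is a shift
  have ha : ∀ n, W2OfK K N S Mt S₂ M₂ ν (translate M' y' n) μ y x z a c
      = W2OfK K N S Mt S₂ M₂ ν y' μ (translate M' y (-n)) (translate M x (-n)) (translate M z (-n)) a c := by
    intro n; rw [W2OfK_copy_eq_shiftK M hM hKs hSs hMs hS₂s hM₂s ν y' μ y n, shiftK_eq_translate]
  -- (b) `dper` through the copy sum (moving centres `N•y′ + M∘n`)
  have hb := (dper_tsum_family' M (T := fun n => shiftK (fun i => (M i : ℤ) * (-n) i) (W2OfK K N S Mt S₂ M₂ ν y' μ (translate M' y (-n))))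
    (p := fun n => translate M ((N : ℤ) • y') n) (g := fun n => Cw * Real.exp (-δw * l1 (translate M ((N : ℤ) • y') n - (N : ℤ) • y)))
    (fun n x z a c => by
      rw [shiftK_eq_translate]
      have h := hW ν y' μ (translate M' y (-n)) (translate M x (-n)) (translate M z (-n)) a c
      have e1 : l1 ((N : ℤ) • translate M' y (-n) - (N : ℤ) • y') = l1 (translate M ((N : ℤ) • y') n - (N : ℤ) • y) := by
        rw [nsmul_translate hM, l1_sub_symm]; congr 1; funext i; simp only [Pi.sub_apply, translate_apply, Pi.neg_apply, mul_neg]; ring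
      have e2 : ∀ w : Site (d + 1), translate M w (-n) - (N : ℤ) • y' = w - translate M ((N : ℤ) • y') n := fun w => by
        funext i; simp only [Pi.sub_apply, translate_apply, Pi.neg_apply, mul_neg]; ring
      rwa [e1, e2, e2] at h)
    (((summable_exp_l1_translate M hδw ((N : ℤ) • y) ((N : ℤ) • y')).1).mul_left Cw) (fun n => by positivity) hδw x z a c).1
  -- (e) `dper` through the copy sum of the bonds-exchanged family (fixed centre `N•y′`)
  have he := (dper_tsum_family' M (T := fun n => W2OfK K N S Mt S₂ M₂ ν y' μ (translate M' y n)) (p := fun _ => (N : ℤ) • y')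
    (g := fun n => Cw * Real.exp (-δw * l1 (translate M ((N : ℤ) • y) n - (N : ℤ) • y'))) (fun n x z a c => by
      have h := hW ν y' μ (translate M' y n) x z a c
      rwa [nsmul_translate hM] at h)
    (((summable_exp_l1_translate M hδw ((N : ℤ) • y') ((N : ℤ) • y)).1).mul_left Cw) (fun n => by positivity) hδw x z a c).1
  have hfe := congrFun (congrFun (congrFun (congrFun
    (dper_tsum_W2OfK_translate M hM hKinv hK hCK hδK hSt hS hδS hMt hMloc hδM hS₂ hδ₂ hM₂ hδm hM₂t ν y' μ y) x) z) a) c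
  calc dper M (fun x z a c => ∑' n : Site (d + 1), W2OfK K N S Mt S₂ M₂ ν (translate M' y' n) μ y x z a c) x z a c
      = dper M (fun x z a c => ∑' n : Site (d + 1),
          shiftK (fun i => (M i : ℤ) * (-n) i) (W2OfK K N S Mt S₂ M₂ ν y' μ (translate M' y (-n))) x z a c) x z a c := by
        congr 1; funext x' z' a' c'; refine tsum_congr fun n => ?_
        rw [W2OfK_copy_eq_shiftK M hM hKs hSs hMs hS₂s hM₂s ν y' μ y n]
    _ = ∑' n : Site (d + 1), dper M (W2OfK K N S Mt S₂ M₂ ν y' μ (translate M' y (-n))) x z a c := by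
        rw [hb]; exact tsum_congr fun n => by rw [dper_shiftK_per]
    _ = ∑' n : Site (d + 1), dper M (W2OfK K N S Mt S₂ M₂ ν y' μ (translate M' y n)) x z a c :=
        (Equiv.neg (Site (d + 1))).tsum_eq fun n => dper M (W2OfK K N S Mt S₂ M₂ ν y' μ (translate M' y n)) x z a c
    _ = dper M (fun x z a c => ∑' n : Site (d + 1), W2OfK K N S Mt S₂ M₂ ν y' μ (translate M' y n) x z a c) x z a c := he.symm
    _ = _ := hfe

/-! ## §10d `W2SymOfK` copy-summed and periodised -/

omit [∀ μ, NeZero (M μ)] [NeZero N] in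
/-- [folklore] thirds of the exponent, the far factor as the leftover: `e^{−δ(A+B+C)} ≤ e^{−(δ∕3)(|x−q|₁+|z−q|₁)}·e^{−(δ∕3)A}` when `A + B ≥ |x−q|₁`, `A + C ≥ |z−q|₁`. -/
theorem exp_thirds_far {δ A B C X Z : ℝ} (hδ : 0 ≤ δ) (hB : 0 ≤ B) (hC : 0 ≤ C) (hX : X ≤ A + B) (hZ : Z ≤ A + C) :
    Real.exp (-δ * (A + (B + C))) ≤ Real.exp (-(δ / 3) * A) * Real.exp (-(δ / 3) * (X + Z)) := by
  rw [← Real.exp_add, Real.exp_le_exp]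
  nlinarith [mul_nonneg hδ hB, mul_nonneg hδ hC]

omit [NeZero N] in
/-- [folklore] **THE SWAPPED COPY SUM IS LOCALISED AT THE FIXED BOND** `N•b.2`: each copy `W2OfK (b′+M′∘n) b` is a bump at `N•b′.2 + M∘n` with weight
`e^{−δw|N•b′.2 + M∘n − N•b.2|₁}`; thirds of the exponent give `BiLoc (Σ'_n …) (N•b.2) (N•b.2) (Cw·K_{d+1}(δw∕3)) (δw∕3)`. -/
theorem biLoc_tsum_swap (hM : ∀ i, M i = N * M' i) {Cw δw : ℝ}
    (hW : ∀ (μ : Fin (d + 1)) (y : Site (d + 1)) (ν : Fin (d + 1)) (y' : Site (d + 1)),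
      BiLoc (W2OfK K N S Mt S₂ M₂ μ y ν y') ((N : ℤ) • y) ((N : ℤ) • y) (Cw * Real.exp (-δw * l1 ((N : ℤ) • y' - (N : ℤ) • y))) δw)
    (hδw : 0 < δw) (ν : Fin (d + 1)) (y' : Site (d + 1)) (μ : Fin (d + 1)) (y : Site (d + 1)) :
    BiLoc (fun x z a c => ∑' n : Site (d + 1), W2OfK K N S Mt S₂ M₂ ν (translate M' y' n) μ y x z a c) ((N : ℤ) • y) ((N : ℤ) • y)
      (Cw * latticeConst (d + 1) (δw / 3)) (δw / 3) := by
  have hCw : 0 ≤ Cw := by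
    have h := (hW 0 0 0 0).nonneg (Sum.inl 0)
    rwa [sub_self, show l1 (0 : Site (d + 1)) = 0 by simp [l1], mul_zero, Real.exp_zero, mul_one] at h
  have hT : ∀ n x z a c, |W2OfK K N S Mt S₂ M₂ ν (translate M' y' n) μ y x z a c|
      ≤ (Cw * Real.exp (-(δw / 3) * l1 (translate M ((N : ℤ) • y') n - (N : ℤ) • y))) * Real.exp (-(δw / 3) * (l1 (x - (N : ℤ) • y) + l1 (z - (N : ℤ) • y))) := by
    intro n x z a c
    refine (hW ν (translate M' y' n) μ y x z a c).trans ?_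
    rw [nsmul_translate hM, l1_sub_symm ((N : ℤ) • y), mul_assoc, ← Real.exp_add, mul_assoc]
    refine mul_le_mul_of_nonneg_left ?_ hCw
    rw [show -δw * l1 (translate M ((N : ℤ) • y') n - (N : ℤ) • y) + -δw * (l1 (x - translate M ((N : ℤ) • y') n) + l1 (z - translate M ((N : ℤ) • y') n))
      = -δw * (l1 (translate M ((N : ℤ) • y') n - (N : ℤ) • y) + (l1 (x - translate M ((N : ℤ) • y') n) + l1 (z - translate M ((N : ℤ) • y') n))) by ring]
    refine exp_thirds_far hδw.le (l1_nonneg _) (l1_nonneg _) ?_ ?_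
    · have h := ExpKernelCalculus.l1_sub_triangle x (translate M ((N : ℤ) • y') n) ((N : ℤ) • y); linarith
    · have h := ExpKernelCalculus.l1_sub_triangle z (translate M ((N : ℤ) • y') n) ((N : ℤ) • y); linarith
  obtain ⟨hs, hle⟩ := summable_exp_l1_translate M (show 0 < δw / 3 by positivity) ((N : ℤ) • y) ((N : ℤ) • y')
  have h := biLoc_tsum_family (T := fun n => W2OfK K N S Mt S₂ M₂ ν (translate M' y' n) μ y) hT (hs.mul_left Cw)
  refine biLoc_le_mono h (tsum_nonneg fun n => by positivity) ?_ le_rfl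
  rw [tsum_mul_left]
  exact mul_le_mul_of_nonneg_left hle hCw

/-- [folklore] **THE SYMMETRISED SECOND RESPONSE TABLE, COPY-SUMMED IN THE SECOND BOND AND PERIODISED, IS THE SAME TABLE OVER THE PERIODISED SLOTS**:
`dper M (x z ↦ Σ'_n W2SymOfK K N S Mt S₂ M₂ b (b′+M′∘n) x z) = W2SymOfK K N S^per Mt^per S₂^{per,csf} M₂^{per,cs} b b′` (under the record's block covariances). -/
theorem dper_tsum_W2SymOfK_translate (hM : ∀ i, M i = N * M' i) (hKs : ∀ t : Site (d + 1), shiftK (-((N : ℤ) • t)) K = K)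
    (hK : Decays K CK δK) (hCK : 0 ≤ CK) (hδK : 0 < δK)
    (hSs : ∀ (κ : Fin (d + 1)) (u t : Site (d + 1)), S κ (u + (N : ℤ) • t) = shiftK (-((N : ℤ) • t)) (S κ u))
    (hS : ∀ κ u, BiLoc (S κ u) u u CS δS) (hδS : 0 < δS)
    (hMs : ∀ (ρ : Fin (d + 1)) (w t : Site (d + 1)), Mt ρ (w + t) = shiftK (-((N : ℤ) • t)) (Mt ρ w))
    (hMloc : VertexFamily Mt N CM δM) (hδM : 0 < δM)
    (hS₂s : ∀ (κ : Fin (d + 1)) (u : Site (d + 1)) (κ' : Fin (d + 1)) (u' t : Site (d + 1)),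
      S₂ κ (u + (N : ℤ) • t) κ' (u' + (N : ℤ) • t) = shiftK (-((N : ℤ) • t)) (S₂ κ u κ' u'))
    (hS₂ : LocStencil₂ S₂ C₂ δ₂) (hδ₂ : 0 < δ₂)
    (hM₂s : ∀ (κ : Fin (d + 1)) (u : Site (d + 1)) (ρ : Fin (d + 1)) (w t : Site (d + 1)),
      M₂ κ (u + (N : ℤ) • t) ρ (w + t) = shiftK (-((N : ℤ) • t)) (M₂ κ u ρ w))
    (hM₂ : LocStencilFM N M₂ Cm δm) (hδm : 0 < δm) (μ : Fin (d + 1)) (y : Site (d + 1)) (ν : Fin (d + 1)) (y' : Site (d + 1)) :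
    dper M (fun x z a c => ∑' n : Site (d + 1), W2SymOfK K N S Mt S₂ M₂ μ y ν (translate M' y' n) x z a c)
      = W2SymOfK K N (fun κ u => dper M (S κ u)) (fun ρ w => dper M (Mt ρ w))
          (fun κ u κ' u' => dper M (fun x z a c => ∑' n : Site (d + 1), S₂ κ u κ' (translate M u' n) x z a c))
          (fun κ u ρ w => dper M (fun x z a c => ∑' n : Site (d + 1), M₂ κ u ρ (translate M' w n) x z a c)) μ y ν y' := by
  have hLM : ∀ i, N ∣ M i := fun i => ⟨M' i, hM i⟩
  have hKinv : ∀ (m x z : Site (d + 1)) (a b : Fib d), K (translate M x m) (translate M z m) a b = K x z a b :=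
    translate_invariant_of_shiftK M (shiftK_pos_of_neg hKs) hLM
  have hSt := periodCov_of_shiftK_cov M hSs hLM
  have hMt := cperiodCov_of_shiftK_cov' M hM hMs
  have hM₂t := fmperiodCov_of_shiftK_cov M hM hM₂s
  obtain ⟨Cw, δw, hδw, hW⟩ := exists_farSmall_W2OfK (N := N) hK hCK hδK hS hδS hMloc hδM hS₂ hδ₂ hM₂ hδm
  have hCw : 0 ≤ Cw := by
    have h := (hW 0 0 0 0).nonneg (Sum.inl 0)
    rwa [sub_self, show l1 (0 : Site (d + 1)) = 0 by simp [l1], mul_zero, Real.exp_zero, mul_one] at h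
  -- the two orientations' copy sums as kernels, both bi-localised at `N•y`
  have hTA : ∀ n x z a c, |W2OfK K N S Mt S₂ M₂ μ y ν (translate M' y' n) x z a c|
      ≤ (Cw * Real.exp (-δw * l1 (translate M ((N : ℤ) • y') n - (N : ℤ) • y))) * Real.exp (-δw * (l1 (x - (N : ℤ) • y) + l1 (z - (N : ℤ) • y))) := by
    intro n x z a c
    have h := hW μ y ν (translate M' y' n) x z a c
    rwa [nsmul_translate hM] at h
  have hgA := ((summable_exp_l1_translate M hδw ((N : ℤ) • y) ((N : ℤ) • y')).1).mul_left Cw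
  have hA := biLoc_tsum_family (T := fun n => W2OfK K N S Mt S₂ M₂ μ y ν (translate M' y' n)) hTA hgA
  have hB := biLoc_tsum_swap M hM hW hδw ν y' μ y
  have sA := fun x z a c => CombHId2CopySum.summable_family_apply hTA hgA x z a c
  -- pointwise summability of the swapped copies: each copy is bounded by `Cw·e^{−δw|translate M (N•y′) n − N•y|₁}·1`
  have sB : ∀ x z a c, Summable fun n : Site (d + 1) => W2OfK K N S Mt S₂ M₂ ν (translate M' y' n) μ y x z a c := by
    intro x z a c
    refine Summable.of_norm_bounded hgA fun n => ?_
    rw [Real.norm_eq_abs]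
    refine (hW ν (translate M' y' n) μ y x z a c).trans ?_
    rw [nsmul_translate hM, l1_sub_symm ((N : ℤ) • y)]
    have h1 : Real.exp (-δw * (l1 (x - translate M ((N : ℤ) • y') n) + l1 (z - translate M ((N : ℤ) • y') n))) ≤ 1 := by
      rw [Real.exp_le_one_iff]; exact mul_nonpos_of_nonpos_of_nonneg (neg_nonpos.2 hδw.le) (add_nonneg (l1_nonneg _) (l1_nonneg _))
    calc Cw * Real.exp (-δw * l1 (translate M ((N : ℤ) • y') n - (N : ℤ) • y))
          * Real.exp (-δw * (l1 (x - translate M ((N : ℤ) • y') n) + l1 (z - translate M ((N : ℤ) • y') n)))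
        ≤ Cw * Real.exp (-δw * l1 (translate M ((N : ℤ) • y') n - (N : ℤ) • y)) * 1 := mul_le_mul_of_nonneg_left h1 (by positivity)
      _ = _ := mul_one _
  -- the copy sum of the symmetrised table is `½ • (A + B)`
  have h1 : (fun x z a c => ∑' n : Site (d + 1), W2SymOfK K N S Mt S₂ M₂ μ y ν (translate M' y' n) x z a c)
      = (1 / 2 : ℝ) • (fun x z a c => ∑' n : Site (d + 1), W2OfK K N S Mt S₂ M₂ μ y ν (translate M' y' n) x z a c)
        + (1 / 2 : ℝ) • (fun x z a c => ∑' n : Site (d + 1), W2OfK K N S Mt S₂ M₂ ν (translate M' y' n) μ y x z a c) := by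
    funext x z a c
    simp only [Pi.add_apply, Pi.smul_apply, smul_eq_mul]
    rw [← tsum_mul_left, ← tsum_mul_left, ← ((sA x z a c).mul_left (1 / 2)).tsum_add ((sB x z a c).mul_left (1 / 2))]
    refine tsum_congr fun n => ?_
    simp only [W2SymOfK, Pi.add_apply, Pi.smul_apply, smul_eq_mul]
    ring
  rw [h1, CombHId2Record.dper_smul_add_smul M hA hδw hB (by positivity),
    dper_tsum_W2OfK_translate M hM hKinv hK hCK hδK hSt hS hδS hMt hMloc hδM hS₂ hδ₂ hM₂ hδm hM₂t μ y ν y',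
    dper_tsum_W2OfK_translate_swap M hM hKs hK hCK hδK hSs hS hδS hMs hMloc hδM hS₂s hS₂ hδ₂ hM₂s hM₂ hδm ν y' μ y]
  funext x z a c
  simp only [W2SymOfK, Pi.add_apply, Pi.smul_apply, smul_eq_mul]
  ring

end Summit.QuantumFields.BalabanUV.Beta.CombHId2W2SymSwap

end
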